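import Summits.ResolutionOfSingularities.ResolutionOfSingularities.Theorems.ValuativeLuAlphaPTorsorBirationalExit
import Mathlib.FieldTheory.IntermediateField.Adjoin.Basic
import HarnessLib

/-!
# The torsor extension `K / K₀` is finite and valuation rings of `K` are determined on `K₀`

Crux `Valuative.LuAlphaPTorsor` (item `stmt-ResolutionOfSingularities-0641`), line
`pfaff-line-log-final-forms`, registered helper stub `torsorExtension_finite_unique` (toward
`stub_dimTwoImmediate` and the dimension-two defectless corollary).

Setting: `k` a field of characteristic `p`, `K ⊇ k` a field, `A₀ ⊆ K` a `k`-subalgebra, `t ∈ K`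
with `t ^ p ∈ A₀` and `Frac (A₀[t]) = K`. Write `K₀ := IntermediateField.adjoin k A₀ ⊆ K` (the
intermediate field generated by `A₀`, i.e. `Frac A₀` realised inside `K`, as a TYPE carrying
`Algebra K₀ K`).

**Claims** (`torsorExtension_finite_unique`).
1. `K` is finite-dimensional over `K₀`: `K = K₀(t)` (every element of `K` is a quotient of two
   elements of `A₀[t] ⊆ K₀(t)`) and `t` is integral over `K₀` (`t ^ p ∈ K₀`).
2. A valuation ring `O''` of `K` is determined by its trace `O'' ∩ K₀` on `K₀`: in characteristic
   `p` the Frobenius preimage of `K₀` is a subfield of `K` containing `A₀` and `t`, hence all of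
   `K = Frac (A₀[t])`, so `z ^ p ∈ K₀` for every `z ∈ K`; and `z ∈ O'' ↔ z ^ p ∈ O''`
   (valuation rings are integrally closed).
3. `K₀` and `Subfield.closure A₀` have the same carrier, because `k ⊆ A₀`.

Log: (1) direct proof, Mathlib `IntermediateField` / `ValuationSubring` API and the small
subalgebra helpers of `…BirationalExit.lean`.
-/

-- single-problem summit: the doubled namespace component `ResolutionOfSingularities` is forced
set_option linter.dupNamespace false

namespace Summit.ResolutionOfSingularities.ResolutionOfSingularities.Theorems.PfaffLine

section Helpers

variable {k K : Type} [Field k] [Field K] [Algebra k K]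

/-- The intermediate field generated by a `k`-subalgebra `A₀ ⊆ K` has the same carrier as the
subfield generated by `A₀` (indeed `k ⊆ A₀`). [folklore] -/
theorem torsorExt_coe_adjoin_eq_coe_closure (A₀ : Subalgebra k K) :
    ((IntermediateField.adjoin k (A₀ : Set K) : IntermediateField k K) : Set K) =
      (Subfield.closure (A₀ : Set K) : Set K) := by
  have h : Subfield.closure (Set.range (algebraMap k K) ∪ (A₀ : Set K)) =
      Subfield.closure (A₀ : Set K) := by
    refine le_antisymm (Subfield.closure_le.mpr ?_)
      (Subfield.closure_mono Set.subset_union_right)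
    rintro x (⟨c, rfl⟩ | hx)
    · exact Subfield.subset_closure (A₀.algebraMap_mem c)
    · exact Subfield.subset_closure hx
  rw [← IntermediateField.coe_toSubfield, IntermediateField.adjoin_toSubfield, h]

/-- If `t ^ p ∈ A₀` and `Frac (A₀[t]) = K` in characteristic `p`, then `z ^ p ∈ K₀ = k(A₀)` for
every `z ∈ K`: the Frobenius preimage of `K₀` is a subfield of `K` containing `A₀` and `t`.
[folklore] -/
theorem torsorExt_pow_mem_adjoin {p : ℕ} (hp : p.Prime) [CharP K p] (A₀ : Subalgebra k K)
    (t : K) (htp : t ^ p ∈ A₀)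
    (hfr : IsFractionRing (Algebra.adjoin k (insert t (A₀ : Set K))) K) (z : K) :
    z ^ p ∈ IntermediateField.adjoin k (A₀ : Set K) := by
  haveI : ExpChar K p := ExpChar.prime hp
  -- the Frobenius preimage of `K₀`
  let F : Subfield K := (IntermediateField.adjoin k (A₀ : Set K)).toSubfield.comap (frobenius K p)
  have hF : ∀ x : K, x ∈ F ↔ x ^ p ∈ IntermediateField.adjoin k (A₀ : Set K) := fun x => by
    rw [Subfield.mem_comap, frobenius_def]
    rfl
  have hA : (Algebra.adjoin k (insert t (A₀ : Set K))).toSubring ≤ F.toSubring :=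
    adjoin_insert_toSubring_le F.toSubring A₀
      (fun x hx => (hF x).mpr (IntermediateField.subset_adjoin k _ (pow_mem hx p)))
      ((hF t).mpr (IntermediateField.subset_adjoin k _ htp))
  haveI : IsFractionRing (Algebra.adjoin k (insert t (A₀ : Set K))).toSubring K := hfr
  obtain ⟨x, y, -, rfl⟩ :=
    IsFractionRing.div_surjective (A := (Algebra.adjoin k (insert t (A₀ : Set K))).toSubring) z
  exact (hF _).mp (div_mem (hA x.2) (hA y.2))

/-- If `Frac (A₀[t]) = K`, then `K = K₀(t)` for `K₀ = k(A₀)`. [folklore] -/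
theorem torsorExt_adjoin_simple_eq_top (A₀ : Subalgebra k K) (t : K)
    (hfr : IsFractionRing (Algebra.adjoin k (insert t (A₀ : Set K))) K) :
    IntermediateField.adjoin (IntermediateField.adjoin k (A₀ : Set K)) {t} = ⊤ := by
  rw [eq_top_iff]
  intro z _
  have hA : (Algebra.adjoin k (insert t (A₀ : Set K))).toSubring ≤
      (IntermediateField.adjoin (IntermediateField.adjoin k (A₀ : Set K)) {t}).toSubfield.toSubring :=
    adjoin_insert_toSubring_le _ A₀
      (fun a ha => (IntermediateField.adjoin (IntermediateField.adjoin k (A₀ : Set K))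
        {t}).algebraMap_mem ⟨a, IntermediateField.subset_adjoin k _ ha⟩)
      (IntermediateField.mem_adjoin_simple_self _ t)
  haveI : IsFractionRing (Algebra.adjoin k (insert t (A₀ : Set K))).toSubring K := hfr
  obtain ⟨x, y, -, rfl⟩ :=
    IsFractionRing.div_surjective (A := (Algebra.adjoin k (insert t (A₀ : Set K))).toSubring) z
  exact div_mem (hA x.2) (hA y.2)

/-- If `t ^ p ∈ A₀` (`p` prime) and `Frac (A₀[t]) = K`, then `K` is finite-dimensional over
`K₀ = k(A₀)`: `K = K₀(t)` with `t` integral over `K₀`. [folklore] -/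
theorem torsorExt_finiteDimensional {p : ℕ} (hp : p.Prime) (A₀ : Subalgebra k K) (t : K)
    (htp : t ^ p ∈ A₀) (hfr : IsFractionRing (Algebra.adjoin k (insert t (A₀ : Set K))) K) :
    FiniteDimensional (IntermediateField.adjoin k (A₀ : Set K)) K := by
  have hint : IsIntegral (IntermediateField.adjoin k (A₀ : Set K)) t := by
    refine IsIntegral.of_pow hp.pos ?_
    have ht : t ^ p = algebraMap (IntermediateField.adjoin k (A₀ : Set K)) K
        ⟨t ^ p, IntermediateField.subset_adjoin k _ htp⟩ := rfl
    rw [ht]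
    exact isIntegral_algebraMap
  have hfin := IntermediateField.adjoin.finiteDimensional hint
  rw [torsorExt_adjoin_simple_eq_top A₀ t hfr] at hfin
  exact IntermediateField.topEquiv.toLinearEquiv.finiteDimensional

/-- If `t ^ p ∈ A₀` and `Frac (A₀[t]) = K` in characteristic `p`, then a valuation ring of `K` is
determined by its trace on `K₀ = k(A₀)`: `z ∈ O'' ↔ z ^ p ∈ O''` and `z ^ p ∈ K₀`. [folklore] -/
theorem torsorExt_valuationSubring_eq_of_comap_eq {p : ℕ} (hp : p.Prime) [CharP K p]
    (A₀ : Subalgebra k K) (t : K) (htp : t ^ p ∈ A₀)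
    (hfr : IsFractionRing (Algebra.adjoin k (insert t (A₀ : Set K))) K)
    (O O'' : ValuationSubring K)
    (h : O''.comap (algebraMap (IntermediateField.adjoin k (A₀ : Set K)) K) =
      O.comap (algebraMap (IntermediateField.adjoin k (A₀ : Set K)) K)) :
    O'' = O := by
  ext z
  have hz := torsorExt_pow_mem_adjoin hp A₀ t htp hfr z
  have key : ∀ O₁ : ValuationSubring K, z ∈ O₁ ↔
      (⟨z ^ p, hz⟩ : IntermediateField.adjoin k (A₀ : Set K)) ∈
        O₁.comap (algebraMap (IntermediateField.adjoin k (A₀ : Set K)) K) := fun O₁ =>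
    ⟨fun hzO => pow_mem hzO p, fun hzO => mem_valuationSubring_of_pow_mem O₁ hp.ne_zero hzO⟩
  rw [key O'', key O, h]

end Helpers

/-- **The torsor extension is finite and valuation rings are determined on the base field**
(registered helper stub `torsorExtension_finite_unique` of line `pfaff-line-log-final-forms`).
For `k` of characteristic `p`, `A₀ ⊆ K` a `k`-subalgebra, `t ^ p ∈ A₀` with `Frac (A₀[t]) = K`,
and `K₀ := IntermediateField.adjoin k A₀`: (1) `K / K₀` is finite-dimensional (`K = K₀(t)`,
`t` integral); (2) a valuation ring `O''` of `K` with the same trace on `K₀` as `O` equals `O`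
(`z ∈ O'' ↔ z ^ p ∈ O''`, and `z ^ p ∈ K₀` for all `z ∈ K` in characteristic `p`); (3) `K₀` has
the same carrier as `Subfield.closure A₀` (as `k ⊆ A₀`). [folklore] -/
theorem torsorExtension_finite_unique :
    ∀ p : ℕ, p.Prime → ∀ (k K : Type) [Field k] [CharP k p] [Field K] [Algebra k K] (O : ValuationSubring K) (A₀ : Subalgebra k K) (t : K), t ^ p ∈ A₀ → IsFractionRing (Algebra.adjoin k (insert t (A₀ : Set K))) K → FiniteDimensional (IntermediateField.adjoin k (A₀ : Set K)) K ∧ (∀ O'' : ValuationSubring K, O''.comap (algebraMap (IntermediateField.adjoin k (A₀ : Set K)) K) = O.comap (algebraMap (IntermediateField.adjoin k (A₀ : Set K)) K) → O'' = O) ∧ ((IntermediateField.adjoin k (A₀ : Set K) : Set K) = (Subfield.closure (A₀ : Set K) : Set K)) := by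
  intro p hp k K _ _ _ _ O A₀ t htp hfr
  haveI : CharP K p := charP_of_injective_algebraMap (algebraMap k K).injective p
  exact ⟨torsorExt_finiteDimensional hp A₀ t htp hfr,
    fun O'' hO'' => torsorExt_valuationSubring_eq_of_comap_eq hp A₀ t htp hfr O O'' hO'',
    torsorExt_coe_adjoin_eq_coe_closure A₀⟩

end Summit.ResolutionOfSingularities.ResolutionOfSingularities.Theorems.PfaffLine
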